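import Mathlib
import Literature.NumberTheory.Irrationality.Lai2025TwoAdic.GeneralRationalFunctionA
import Literature.NumberTheory.Irrationality.Lai2025TwoAdic.GeneralLinearFormsT
import Literature.Algebra.Module.LocalGlobalLattice
import HarnessLib

/-!
# Lai 2025 (IJNT, `2`-adic zeta values), §3–§4 for GENERAL `s`, the `A`-family: the linear forms
# `S_n = ∫_{ℤ₂} A_n^{(s)}(t+¼)dt = ρ_{n,0} + Σ_{i=2}^{2s+4} ρ_{n,i}·ζ₂(i+s+1,¼)` (Lemma 3.3) and the `d_n`-parts of
# Lemmas 4.5–4.6 (`d_n^{2s+4−i}ρ_{n,i} ∈ ℤ`, `d_n^{3s+5}ρ_{n,0} ∈ ℤ`), and Lemma 5.2 (`|ρ_{n,i}| ≤ n^{O(s)}2^{(6s+12)n}`) — PROVED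

Topic `Literature/NumberTheory/Irrationality/Lai2025TwoAdic`.  Source: L. Lai, *On the irrationality of certain
`2`-adic zeta values*, Int. J. Number Theory (2025) = arXiv:2304.00816 [Lai2025TwoAdicZeta], §3 (Definition 3.2,
Lemma 3.3) and §4 (Lemmas 4.5, 4.6) (held text `paper:arxiv-2304.00816`, chunks p0007–p0009, read on the page).
PROOF FILE (definitions with bodies + theorems; no named fact, net debt 0): second file of the groundwork for the
tree's named fact `PAdicZetaValues.lai2025TwoAdic_theorem12` ([Lai2025TwoAdicZeta, Thm 1.2]); the `A`-twin of the
sibling `GeneralLinearFormsT.lean` (same proofs, pole orders `2s+4` instead of `s+2`, exponents `3s+5` instead of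
`2s+3`).  NOT formalised here (needed later for Thm 1.2): the `Φ_n^{−(s+2)}`-refinement of Lemmas 4.5–4.6 (via
Lemmas 4.3–4.4), Lemma 5.1 (`Φ_n` asymptotics), §§6–7.

## Source, as printed ([Lai2025TwoAdicZeta, §3–§4])

* **Definition 3.2.** «`S_n := ∫_{ℤ₂} A_n^{(s)}(t+¼) dt ∈ ℚ₂`.»
* **Lemma 3.3.** «`S_n = ρ_{n,0} + Σ_{2 ≤ i ≤ 2s+4, i ≡ δ (mod 2)} ρ_{n,i} ζ₂(i+s+1, ¼)`, where
  `ρ_{n,0} = (−1)^{s+1}Σ_{i=1}^{2s+4}Σ_{k=1}^{n}Σ_{ℓ=0}^{k−1} (i)_{s+1}a_{n,i,k}/(ℓ+¼)^{i+s+1}`,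
  `ρ_{n,i} = (−1)^s(i)_{s+1}4^{i+s}Σ_{k=0}^{n} a_{n,i,k}` (`1 ≤ i ≤ 2s+4`)»; proof: «`A_n^{(s)}(t+¼) =
  (−1)^sΣΣ (i)_s a_{n,i,k}/(t+k+¼)^{i+s}`», Lemma 2.2 (translation) and Lemma 2.6, «`ρ_{n,1} = 0` since `deg A_n ≤ −2`»,
  and the symmetry «`A_n(−t−n) = (−1)^δA_n(t)` … So `ρ_{n,i} = 0` when `i > 0` and `i ≢ δ (mod 2)`».
* **Lemma 4.5 / 4.6** (`d_n`-parts of (rho_i_ari), (rho_0_ari)): «`Φ_n^{−s−2}d_n^{2s+4−i}ρ_{n,i} ∈ ℤ`»,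
  «`Φ_n^{−s−2}d_n^{3s+5}ρ_{n,0} ∈ ℤ`» — here WITHOUT the factor `Φ_n^{−s−2}`; the proof of 4.6 as printed («`t = −k₀+ℓ₀+¼`
  is a root of `A_n(t)` with multiplicity `s+2` … a root of `A_n^{(s+1)}` … `v_q(−k₀+k₁) > v_q(d_n)` … contradicts
  `0 < |−k₀+k₁| ≤ n`»).

## What is formalised (all PROVED)

* `iteratedDeriv_As` (derivatives through (def_a)), `iteratedDeriv_As_quarter_eq_zero` (roots of `A_n^{(s+1)}` at
  `¼ − m`), `DAsq`/`DAs` (the integrand `A_n^{(s)}(t+¼)` over `ℚ` and on `ℤ₂`), **Definition 3.2** `Ss s δ n`.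
* `rhoI`, `rhoZero`, `XtermA`; `rhoI_one` (`ρ_{n,1} = 0`), `rhoI_eq_zero_of_odd` (parity); **Lemma 3.3** `Ss_eq`
  (stated with the full sum over `2 ≤ i ≤ 2s+4`; the terms with `i ≢ δ` vanish by `rhoI_eq_zero_of_odd`),
  `tendsto_volkenbornSum_DAs_Ss`.
* **Lemma 4.5 (d_n-part)** `exists_int_lcm_pow_mul_rhoI` (`d_n^{2s+4−i}ρ_{n,i} ∈ ℤ`), `exists_int_lcm_pow_mul_rhoI'`
  (`d_n^{3s+5}ρ_{n,i} ∈ ℤ`); **Lemma 4.6 (d_n-part)** `exists_int_lcm_pow_mul_rhoZero` (`d_n^{3s+5}ρ_{n,0} ∈ ℤ`), prime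
  by prime through the root relation `sum_XtermA_root_eq_zero` and the tree's `not_dvd_both`.
* **Lemma 5.2 for `ρ`** (explicit form, `δ ≤ 1`): `abs_rhoI_le`, `abs_rhoZero_le` —
  `|ρ_{n,i}|, |ρ_{n,0}| ≤ K_ρ(s)·(n+1)^{2s+6}·2^{(6s+12)n}` with `Krho s = (2s+5)(3s+4)^{s+1}4^{3s+6}(10(s+2))^{2s+3}`
  (printed: `max_i|ρ_{n,i}| ≤ 2^{(6s+12+o(1))n}`).

Cell zeta5-irr / pub-zeta5 (HONEST FRAMING: systematic search; no irrationality claim unless kernel-certified):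
auxiliary `2`-adic material; nothing here bears on `ζ(5) ∈ ℝ`.
-/

noncomputable section

namespace Literature.NumberTheory.Irrationality.Lai2025TwoAdic

section GeneralLinearFormsA

open Finset Filter Topology
open Literature.Analysis.Calculus
open Literature.NumberTheory.LocalFields
open Literature.NumberTheory.Transcendental
open Literature.NumberTheory.Irrationality.PAdicZetaValues
open scoped Nat

/-! ## §1. The derivatives of `A_n` through (def_a) -/

/-- A term `a·(t+k)^{−i}` of (def_a) is smooth off `−k`. [folklore] -/
private theorem contDiffAt_const_mul_inv_pow' {x : ℚ} (b : ℚ) (k i : ℕ) (hxk : x + k ≠ 0) {N : WithTop ℕ∞} :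
    ContDiffAt ℚ N (fun t : ℚ => b * ((t + k) ^ i)⁻¹) x :=
  contDiffAt_const.mul (((contDiffAt_id.add contDiffAt_const).pow i).inv (pow_ne_zero _ hxk))

/-- **The derivatives of `A_n` through (def_a)**: off the poles,
`A_n^{(r)}(x) = (−1)^r Σ_{k=0}^{n} Σ_{i=1}^{2s+4} (i)_r a_{n,i,k} (x+k)^{−(i+r)}` (termwise differentiation of (def_a)).
[cite: Lai2025TwoAdicZeta, Lemma 3.3 (proof: A_n^{(s)}(t+¼) from (def_a)) and Lemma 4.6 (proof: A_n^{(s+1)})] -/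
theorem iteratedDeriv_As (s : ℕ) {δ : ℕ} (hδ : δ ≤ 1) (n r : ℕ) {x : ℚ} (hx : ∀ j ∈ range (n + 1), x + j ≠ 0) :
    iteratedDeriv r (As s δ n) x = (-1) ^ r * ∑ k ∈ range (n + 1), ∑ i ∈ Icc 1 (2 * s + 4),
      (i.ascFactorial r : ℚ) * coeffAs s δ n i k * ((x + k) ^ (i + r))⁻¹ := by
  have heq : (fun t => ∑ k ∈ range (n + 1), ∑ i ∈ Icc 1 (2 * s + 4), coeffAs s δ n i k * ((t + k) ^ i)⁻¹)
      =ᶠ[𝓝 x] As s δ n := by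
    filter_upwards [LaiSprangZudilin2026.eventually_nhds_forall_add_ne_zero (range (n + 1)) hx] with t ht
    rw [As_eq_sum_coeffAs s hδ n ht]
  rw [← heq.iteratedDeriv_eq r]
  have hterm : ∀ k ∈ range (n + 1), ∀ i ∈ Icc 1 (2 * s + 4),
      ContDiffAt ℚ r (fun t : ℚ => coeffAs s δ n i k * ((t + k) ^ i)⁻¹) x :=
    fun k hk i _ => contDiffAt_const_mul_inv_pow' _ k i (hx k hk)
  rw [iteratedDeriv_fun_sum fun k hk => ContDiffAt.sum fun i hi => hterm k hk i hi, mul_sum]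
  refine sum_congr rfl fun k hk => ?_
  rw [iteratedDeriv_fun_sum fun i hi => hterm k hk i hi, mul_sum]
  refine sum_congr rfl fun i _ => ?_
  have hf : ContDiffAt ℚ r (fun t : ℚ => ((t + k) ^ i)⁻¹) x :=
    ((contDiffAt_id.add contDiffAt_const).pow i).inv (pow_ne_zero _ (hx k hk))
  rw [iteratedDeriv_const_mul _ hf, iteratedDeriv_inv_pow_add_const]
  ring

/-- **`A_n^{(s+1)}` vanishes at `¼ − m`** (`1 ≤ m ≤ n`): `A_n` has the factor `(t + ¾ + (m−1))^{s+2}`, a zero of order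
`s+2` («The key point is that `A_n^{(s+1)}(t)` has roots `−1+¼, −2+¼, …, −n+¼`»).
[cite: Lai2025TwoAdicZeta, Lemma 4.6 (proof, last sentence)] -/
theorem iteratedDeriv_As_quarter_eq_zero (s δ n : ℕ) {m : ℕ} (hm1 : 1 ≤ m) (hmn : m ≤ n) :
    iteratedDeriv (s + 1) (As s δ n) ((1 : ℚ) / 4 - m) = 0 := by
  classical
  set t₀ : ℚ := (1 : ℚ) / 4 - m with ht₀
  have hj0 : m - 1 ∈ range n := mem_range.2 (by omega)
  -- the smooth cofactor
  set H : ℚ → ℚ := fun t => (2 : ℚ) ^ ((6 * s + 12) * n) * (4 * t + 2 * n) ^ δ *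
    ((∏ j ∈ range n, (t + 1 / 4 + j)) ^ (s + 2) * (∏ j ∈ (range n).erase (m - 1), (t + 3 / 4 + j)) ^ (s + 2)) /
    (∏ j ∈ range (n + 1), (t + j)) ^ (2 * s + 4) with hH
  have hfac : ∀ t : ℚ, t + 3 / 4 + ((m - 1 : ℕ) : ℚ) = t - t₀ := by
    intro t
    rw [Nat.cast_sub hm1, ht₀]; push_cast; ring
  have hform : As s δ n = fun t => (t - t₀) ^ (s + 2) * H t := by
    funext t
    rw [As, hH, ← mul_prod_erase (range n) (fun j => t + 3 / 4 + (j : ℚ)) hj0, hfac t, mul_pow]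
    ring
  have hden : ∏ j ∈ range (n + 1), (t₀ + j) ≠ 0 := by
    refine prod_ne_zero_iff.2 fun j _ => ?_
    rw [ht₀]
    intro h
    have h4 : (4 * (j : ℤ) - 4 * m + 1 : ℤ) = 0 := by
      have : (4 * (j : ℚ) - 4 * m + 1) = 0 := by linarith
      exact_mod_cast this
    omega
  have hHs : ContDiffAt ℚ ((s + 1 : ℕ) : WithTop ℕ∞) H t₀ := by
    rw [hH]
    refine ContDiffAt.div (by fun_prop) (by fun_prop) (pow_ne_zero _ hden)
  have hD := divDeriv_sub_pow_mul hHs (s + 2)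
  rw [if_pos (by omega : s + 1 < s + 2)] at hD
  rw [hform, iteratedDeriv_eq_factorial_mul_divDeriv, hD, mul_zero]

/-! ## §2. Definition 3.2: the integrand `A_n^{(s)}(t+¼)` and `S_n := ∫_{ℤ₂} A_n^{(s)}(t+¼) dt` -/

/-- The `s`-th derivative `A_n^{(s)}(x + ¼)` in CLOSED FORM through (def_a):
`(−1)^s Σ_{k≤n} Σ_{i=1}^{2s+4} (i)_s a_{n,i,k} (x+k+¼)^{−(i+s)}` (over `ℚ`). [cite: Lai2025TwoAdicZeta, Lemma 3.3 (proof, first display, B-version)] -/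
def DAsq (s δ n : ℕ) (x : ℚ) : ℚ :=
  (-1) ^ s * ∑ k ∈ range (n + 1), ∑ i ∈ Icc 1 (2 * s + 4),
    (i.ascFactorial s : ℚ) * coeffAs s δ n i k * ((x + k + 1 / 4) ^ (i + s))⁻¹

/-- **FIDELITY of the closed form**: `DAsq s δ n x = (d/dx)^s [A_n(x + ¼)]` at every `x` off the shifted poles (in
particular at every natural number). [cite: Lai2025TwoAdicZeta, Definition 3.2 (S_n := ∫ A_n^{(s)}(t+¼)dt) with Lemma 3.3 (proof)] -/
theorem DAsq_eq_iteratedDeriv (s : ℕ) {δ : ℕ} (hδ : δ ≤ 1) (n : ℕ) {x : ℚ} (hx : ∀ j ∈ range (n + 1), x + 1 / 4 + j ≠ 0) :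
    DAsq s δ n x = iteratedDeriv s (fun y => As s δ n (y + 1 / 4)) x := by
  rw [iteratedDeriv_comp_add_const s (As s δ n) (1 / 4)]
  simp only
  rw [iteratedDeriv_As s hδ n s hx, DAsq]
  congr 1
  refine sum_congr rfl fun k _ => sum_congr rfl fun i _ => ?_
  ring_nf

/-- The natural-number instance of the fidelity lemma: `DAsq s δ n m = (A_n(·+¼))^{(s)}(m)`.
[cite: Lai2025TwoAdicZeta, Definition 3.2] -/
theorem DAsq_natCast (s : ℕ) {δ : ℕ} (hδ : δ ≤ 1) (n m : ℕ) : DAsq s δ n m = iteratedDeriv s (fun y => As s δ n (y + 1 / 4)) m :=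
  DAsq_eq_iteratedDeriv s hδ n (natCast_add_quarter_add_ne_zero' n m)

/-- The `2`-adic integrand `A_n^{(s)}(t+¼)` of Definition 3.2 (`t ∈ ℤ₂`), written through (def_a):
`(−1)^s Σ_{k ≤ n}Σ_{i=1}^{2s+4} (i)_s a_{n,i,k}(t+k+¼)^{−(i+s)}`. [cite: Lai2025TwoAdicZeta, Definition 3.2 (S_n) with Lemma 3.3 (proof, first display)] -/
def DAs (s δ n : ℕ) (t : ℤ_[2]) : ℚ_[2] :=
  (-1) ^ s * ∑ k ∈ range (n + 1), ∑ i ∈ Icc 1 (2 * s + 4),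
    ((((i.ascFactorial s : ℚ) * coeffAs s δ n i k : ℚ)) : ℚ_[2]) * ((t : ℚ_[2]) + k + 1 / 4) ^ (-((i + s : ℕ) : ℤ))

/-- At natural numbers the `2`-adic integrand is the rational number `DAsq s δ n m`. [cite: Lai2025TwoAdicZeta, Definition 3.2] -/
theorem DAs_natCast (s δ n m : ℕ) : DAs s δ n (m : ℤ_[2]) = ((DAsq s δ n m : ℚ) : ℚ_[2]) := by
  have e : ∀ (t : ℚ_[2]) (a : ℕ), t ^ (-(a : ℤ)) = (t ^ a)⁻¹ := fun t a => by rw [zpow_neg, zpow_natCast]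
  simp only [DAs, DAsq, e]
  push_cast
  rfl

/-- **Definition 3.2** (general `s`): `S_n := ∫_{ℤ₂} A_n^{(s)}(t+¼) dt` (tree `volkenbornIntegral`; the Riemann sums
converge, `tendsto_volkenbornSum_DAs`). [cite: Lai2025TwoAdicZeta, Definition 3.2 (S_n)] -/
def Ss (s δ n : ℕ) : ℚ_[2] := volkenbornIntegral 2 (DAs s δ n)

/-! ## §3. The coefficients `ρ_{n,i}`, `ρ_{n,0}` of Lemma 3.3 -/

/-- **`ρ_{n,i}`**: `ρ_{n,i} = (−1)^s (i)_{s+1} 4^{i+s} Σ_{k=0}^{n} a_{n,i,k}` (`1 ≤ i ≤ 2s+4`). [cite: Lai2025TwoAdicZeta, Lemma 3.3 (ρ_{n,i})] -/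
def rhoI (s δ n i : ℕ) : ℚ :=
  (-1) ^ s * (i.ascFactorial (s + 1) : ℚ) * 4 ^ (i + s) * ∑ k ∈ range (n + 1), coeffAs s δ n i k

/-- The inner sum `X_{n,k}(y) := Σ_{i=1}^{2s+4} (i)_{s+1}·a_{n,i,k}·y^{−(i+s+1)}` (so that
`ρ_{n,0} = (−1)^{s+1}Σ_{k}Σ_{ℓ<k} X_{n,k}(ℓ+¼)` and `A_n^{(s+1)}(t) = (−1)^{s+1}Σ_k X_{n,k}(t+k)`).
[cite: Lai2025TwoAdicZeta, Lemma 3.3 (def. of ρ_{n,0}) and Lemma 4.6 (proof)] -/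
def XtermA (s δ n k : ℕ) (y : ℚ) : ℚ :=
  ∑ i ∈ Icc 1 (2 * s + 4), (i.ascFactorial (s + 1) : ℚ) * coeffAs s δ n i k * (y ^ (i + s + 1))⁻¹

/-- **`ρ_{n,0}`**: `ρ_{n,0} = (−1)^{s+1} Σ_{i=1}^{2s+4}Σ_{k=1}^{n}Σ_{ℓ=0}^{k−1} (i)_{s+1}a_{n,i,k}/(ℓ+¼)^{i+s+1}` (the `k = 0`
term is an empty sum). [cite: Lai2025TwoAdicZeta, Lemma 3.3 (ρ_{n,0})] -/
def rhoZero (s δ n : ℕ) : ℚ :=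
  (-1) ^ (s + 1) * ∑ k ∈ range (n + 1), ∑ ℓ ∈ range k, XtermA s δ n k ((ℓ : ℚ) + 1 / 4)

/-- **`ρ_{n,1} = 0`.** [cite: Lai2025TwoAdicZeta, Lemma 3.3 (proof: "we have ρ_{n,1} = 0 since deg A_n(t) ≤ −2")] -/
theorem rhoI_one (s : ℕ) {δ : ℕ} (hδ : δ ≤ 1) (n : ℕ) : rhoI s δ n 1 = 0 := by
  rw [rhoI, sum_coeffAs_one_eq_zero s hδ n, mul_zero]

/-- `(i)_s · (i+s) = (i)_{s+1}`. [folklore] -/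
private theorem ascFactorial_mul_add {R : Type*} [CommRing R] (i s : ℕ) :
    (i.ascFactorial s : R) * ((i : R) + s) = (i.ascFactorial (s + 1) : R) := by
  rw [Nat.ascFactorial_succ]; push_cast; ring

/-! ## §4. Lemma 3.3: `S_n = ρ_{n,0} + Σ_{i=2}^{2s+4} ρ_{n,i}·ζ₂(i+s+1, ¼)` -/

/-- The Riemann sums of `DAs s δ n` as the combination of those of `(t+k+¼)^{−(i+s)}`.
[cite: Lai2025TwoAdicZeta, Lemma 3.3 (proof, second display)] -/
theorem volkenbornSum_DAs (s δ n N : ℕ) : volkenbornSum 2 (DAs s δ n) N =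
    (-1) ^ s * ∑ k ∈ range (n + 1), ∑ i ∈ Icc 1 (2 * s + 4),
      ((((i.ascFactorial s : ℚ) * coeffAs s δ n i k : ℚ)) : ℚ_[2]) *
        volkenbornSum 2 (fun t : ℤ_[2] => ((t : ℚ_[2]) + k + 1 / 4) ^ (-((i + s : ℕ) : ℤ))) N := by
  set f : ℕ → ℕ → ℤ_[2] → ℚ_[2] := fun i k t => ((t : ℚ_[2]) + k + 1 / 4) ^ (-((i + s : ℕ) : ℤ)) with hf
  set G : ℕ → ℤ_[2] → ℚ_[2] := fun k t => ∑ i ∈ Icc 1 (2 * s + 4),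
    (fun (i : ℕ) (t : ℤ_[2]) => ((((i.ascFactorial s : ℚ) * coeffAs s δ n i k : ℚ)) : ℚ_[2]) • f i k t) i t with hG
  have hD : DAs s δ n = fun t => ((-1 : ℚ_[2]) ^ s) • ∑ k ∈ range (n + 1), G k t := by
    funext t
    simp only [DAs, hG, hf, smul_eq_mul]
  rw [hD, volkenbornSum_smul, volkenbornSum_finset_sum, smul_eq_mul]
  congr 1
  refine sum_congr rfl fun k _ => ?_
  rw [hG, volkenbornSum_finset_sum]
  refine sum_congr rfl fun i _ => ?_
  rw [volkenbornSum_smul, smul_eq_mul]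

/-- **Lemma 3.3 (the limit)**: the Riemann sums of `A_n^{(s)}(t+¼)` converge `2`-adically to
`ρ_{n,0} + Σ_{i=2}^{2s+4} ρ_{n,i}·ζ₂(i+s+1,¼)` (termwise: Lemma 2.2 then Lemma 2.6,
`∫(t+k+¼)^{−(i+s)} = (i+s)4^{i+s}ζ₂(i+s+1,¼) − (i+s)Σ_{ℓ<k}(ℓ+¼)^{−(i+s+1)}`; the term `i = 1` carries `ρ_{n,1} = 0`).
[cite: Lai2025TwoAdicZeta, Lemma 3.3 (eqn_S_rho) and its proof] -/
theorem tendsto_volkenbornSum_DAs (s : ℕ) {δ : ℕ} (hδ : δ ≤ 1) (n : ℕ) :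
    Tendsto (volkenbornSum 2 (DAs s δ n)) atTop
      (𝓝 (((rhoZero s δ n : ℚ) : ℚ_[2]) +
        ∑ i ∈ Icc 2 (2 * s + 4), ((rhoI s δ n i : ℚ) : ℚ_[2]) * padicHurwitzZeta 2 (i + s + 1) (4 : ℚ_[2])⁻¹)) := by
  -- termwise limits: `A i` (the `ζ₂` part) and `Bsh i k` (the shift correction)
  set A : ℕ → ℚ_[2] := fun i => ((i : ℚ_[2]) + s) * 4 ^ (i + s) * padicHurwitzZeta 2 (i + s + 1) (4 : ℚ_[2])⁻¹
    with hA
  set Bsh : ℕ → ℕ → ℚ_[2] := fun i k => ∑ ℓ ∈ range k, -((i : ℚ_[2]) + s) * (((ℓ : ℚ_[2]) + 1 / 4) ^ (i + s + 1))⁻¹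
    with hBsh
  have hterm : ∀ k : ℕ, ∀ i ∈ Icc 1 (2 * s + 4),
      Tendsto (volkenbornSum 2 (fun t : ℤ_[2] => ((t : ℚ_[2]) + k + 1 / 4) ^ (-((i + s : ℕ) : ℤ)))) atTop
        (𝓝 (A i + Bsh i k)) := by
    intro k i hi
    obtain ⟨i', rfl⟩ : ∃ i', i = i' + 1 := ⟨i - 1, by have := (mem_Icc.1 hi).1; omega⟩
    have h := tendsto_volkenbornSum_quarter_shift_zpow_neg (i' + s) k
    have e1 : (-(((i' + 1 + s : ℕ)) : ℤ)) = -(((i' + s : ℕ) : ℤ) + 1) := by push_cast; ring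
    have hval : ((((i' + s : ℕ)) : ℚ_[2]) + 1) * 4 ^ (i' + s + 1) * padicHurwitzZeta 2 (i' + s + 2) (4 : ℚ_[2])⁻¹ +
        ∑ ℓ ∈ range k, -((((i' + s : ℕ)) : ℚ_[2]) + 1) * (((ℓ : ℚ_[2]) + 1 / 4) ^ (i' + s + 2))⁻¹ =
          A (i' + 1) + Bsh (i' + 1) k := by
      simp only [hA, hBsh, show i' + 1 + s = i' + s + 1 by ring, show i' + s + 1 + 1 = i' + s + 2 by ring]
      push_cast
      ring_nf
    rw [← hval]
    simp_rw [e1]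
    exact h
  have hlim : Tendsto (volkenbornSum 2 (DAs s δ n)) atTop (𝓝 ((-1) ^ s * ∑ k ∈ range (n + 1), ∑ i ∈ Icc 1 (2 * s + 4),
      ((((i.ascFactorial s : ℚ) * coeffAs s δ n i k : ℚ)) : ℚ_[2]) * (A i + Bsh i k))) := by
    have h := (tendsto_finsetSum (range (n + 1)) fun k (_ : k ∈ range (n + 1)) =>
      tendsto_finsetSum (Icc 1 (2 * s + 4)) fun i (hi : i ∈ Icc 1 (2 * s + 4)) =>
        (hterm k i hi).const_mul ((((i.ascFactorial s : ℚ) * coeffAs s δ n i k : ℚ)) : ℚ_[2])).const_mul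
          ((-1 : ℚ_[2]) ^ s)
    refine h.congr fun N => ?_
    rw [volkenbornSum_DAs]
  -- evaluate the limit: the shift corrections give `ρ_{n,0}`
  have hBsum : (-1) ^ s * ∑ k ∈ range (n + 1), ∑ i ∈ Icc 1 (2 * s + 4),
      ((((i.ascFactorial s : ℚ) * coeffAs s δ n i k : ℚ)) : ℚ_[2]) * Bsh i k = ((rhoZero s δ n : ℚ) : ℚ_[2]) := by
    rw [rhoZero]
    push_cast
    rw [pow_succ, mul_assoc, neg_one_mul, ← sum_neg_distrib]
    congr 1
    refine sum_congr rfl fun k _ => ?_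
    simp only [hBsh, mul_sum]
    rw [Finset.sum_comm, ← sum_neg_distrib]
    refine sum_congr rfl fun ℓ _ => ?_
    rw [XtermA]
    push_cast
    rw [← sum_neg_distrib]
    refine sum_congr rfl fun i _ => ?_
    rw [← ascFactorial_mul_add (R := ℚ_[2])]
    ring
  -- and the `ζ₂` parts give `Σ_i ρ_{n,i} ζ₂(i+s+1,¼)`, the term `i = 1` vanishing
  have hAsum : (-1) ^ s * ∑ k ∈ range (n + 1), ∑ i ∈ Icc 1 (2 * s + 4),
      ((((i.ascFactorial s : ℚ) * coeffAs s δ n i k : ℚ)) : ℚ_[2]) * A i =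
      ∑ i ∈ Icc 2 (2 * s + 4), ((rhoI s δ n i : ℚ) : ℚ_[2]) * padicHurwitzZeta 2 (i + s + 1) (4 : ℚ_[2])⁻¹ := by
    rw [Finset.sum_comm, mul_sum]
    have hi : ∀ i ∈ Icc 1 (2 * s + 4), (-1) ^ s * ∑ k ∈ range (n + 1),
        ((((i.ascFactorial s : ℚ) * coeffAs s δ n i k : ℚ)) : ℚ_[2]) * A i =
        ((rhoI s δ n i : ℚ) : ℚ_[2]) * padicHurwitzZeta 2 (i + s + 1) (4 : ℚ_[2])⁻¹ := by
      intro i _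
      rw [rhoI]
      push_cast
      rw [← ascFactorial_mul_add (R := ℚ_[2])]
      simp only [hA, mul_sum, sum_mul]
      exact sum_congr rfl fun k _ => by ring
    rw [sum_congr rfl hi, ← insert_Icc_add_one_left_eq_Icc (by omega : 1 ≤ 2 * s + 4), sum_insert (by simp),
      rhoI_one s hδ n]
    push_cast
    rw [zero_mul, zero_add]
  have hval : (-1) ^ s * ∑ k ∈ range (n + 1), ∑ i ∈ Icc 1 (2 * s + 4),
      ((((i.ascFactorial s : ℚ) * coeffAs s δ n i k : ℚ)) : ℚ_[2]) * (A i + Bsh i k) =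
      ((rhoZero s δ n : ℚ) : ℚ_[2]) +
        ∑ i ∈ Icc 2 (2 * s + 4), ((rhoI s δ n i : ℚ) : ℚ_[2]) * padicHurwitzZeta 2 (i + s + 1) (4 : ℚ_[2])⁻¹ := by
    rw [← hAsum, ← hBsum, add_comm, ← mul_add, ← sum_add_distrib]
    congr 1
    refine sum_congr rfl fun k _ => ?_
    rw [← sum_add_distrib]
    exact sum_congr rfl fun i _ => by ring
  rw [← hval]
  exact hlim

/-- **Lemma 3.3** (general `s`): `S_n = ρ_{n,0} + Σ_{i=2}^{2s+4} ρ_{n,i}·ζ₂(i+s+1, ¼)`, with `ζ₂(j,¼)` the tree's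
`padicHurwitzZeta 2 j 4⁻¹`. [cite: Lai2025TwoAdicZeta, Lemma 3.3 (eqn_S_rho)] -/
theorem Ss_eq (s : ℕ) {δ : ℕ} (hδ : δ ≤ 1) (n : ℕ) :
    Ss s δ n = ((rhoZero s δ n : ℚ) : ℚ_[2]) +
      ∑ i ∈ Icc 2 (2 * s + 4), ((rhoI s δ n i : ℚ) : ℚ_[2]) * padicHurwitzZeta 2 (i + s + 1) (4 : ℚ_[2])⁻¹ :=
  volkenbornIntegral_eq (tendsto_volkenbornSum_DAs s hδ n)

/-- The Riemann sums of `A_n^{(s)}(t+¼)` tend to `S_n`. [cite: Lai2025TwoAdicZeta, Definition 3.2] -/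
theorem tendsto_volkenbornSum_DAs_Ss (s : ℕ) {δ : ℕ} (hδ : δ ≤ 1) (n : ℕ) : Tendsto (volkenbornSum 2 (DAs s δ n)) atTop (𝓝 (Ss s δ n)) := by
  rw [Ss_eq s hδ n]; exact tendsto_volkenbornSum_DAs s hδ n

/-! ## §5. Lemma 4.5 (`d_n^{2s+4−i}ρ_{n,i} ∈ ℤ`) and Lemma 4.6 (`d_n^{3s+5}ρ_{n,0} ∈ ℤ`) -/

/-- **Lemma 4.5 (rho_i_ari), general `s`:** `d_n^{2s+4−i}·ρ_{n,i} ∈ ℤ` (from Lemma 4.2 (ari_b)).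
[cite: Lai2025TwoAdicZeta, Lemma 4.5 (rho_i_ari)] -/
theorem exists_int_lcm_pow_mul_rhoI (s δ n i : ℕ) :
    ∃ z : ℤ, (Nat.lcmUpto n : ℚ) ^ (2 * s + 4 - i) * rhoI s δ n i = z := by
  have h : ∀ k ∈ range (n + 1), ∃ z : ℤ, (Nat.lcmUpto n : ℚ) ^ (2 * s + 4 - i) * coeffAs s δ n i k = z :=
    fun k hk => exists_int_lcm_pow_mul_coeffAs s δ n (by have := mem_range.1 hk; omega) i
  choose! z hz using h
  have hsum : (Nat.lcmUpto n : ℚ) ^ (2 * s + 4 - i) * ∑ k ∈ range (n + 1), coeffAs s δ n i k =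
      ∑ k ∈ range (n + 1), (z k : ℚ) := by
    rw [mul_sum]; exact sum_congr rfl hz
  refine ⟨(-1) ^ s * (i.ascFactorial (s + 1) : ℤ) * 4 ^ (i + s) * ∑ k ∈ range (n + 1), z k, ?_⟩
  calc (Nat.lcmUpto n : ℚ) ^ (2 * s + 4 - i) * rhoI s δ n i = (-1) ^ s * (i.ascFactorial (s + 1) : ℚ) * 4 ^ (i + s) *
        ((Nat.lcmUpto n : ℚ) ^ (2 * s + 4 - i) * ∑ k ∈ range (n + 1), coeffAs s δ n i k) := by rw [rhoI]; ring
    _ = _ := by rw [hsum]; push_cast; ring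

/-- In particular `d_n^{3s+5}ρ_{n,i} ∈ ℤ`. [cite: Lai2025TwoAdicZeta, §7 (proof of Thm 1.2: "d_n^{3s+5}S_n is a linear combination … with integer coefficients")] -/
theorem exists_int_lcm_pow_mul_rhoI' (s δ n i : ℕ) :
    ∃ z : ℤ, (Nat.lcmUpto n : ℚ) ^ (3 * s + 5) * rhoI s δ n i = z := by
  obtain ⟨z, hz⟩ := exists_int_lcm_pow_mul_rhoI s δ n i
  refine ⟨(Nat.lcmUpto n : ℤ) ^ (3 * s + 5 - (2 * s + 4 - i)) * z, ?_⟩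
  push_cast
  rw [← hz, ← mul_assoc, ← pow_add]
  congr 2
  omega

/-! ### The root relation: `A_n^{(s+1)}(¼ − m) = 0` for `1 ≤ m ≤ n`, read through (def_a) -/

/-- **The root relation** (`1 ≤ m ≤ n`): `Σ_{k=0}^{n} Σ_{i=1}^{2s+4} (i)_{s+1}·a_{n,i,k}·(k − m + ¼)^{−(i+s+1)} = 0`, i.e.
`A_n^{(s+1)}(¼ − m) = 0` read through (def_a). [cite: Lai2025TwoAdicZeta, Lemma 4.6 (proof: "t = −k₀+ℓ₀+¼ is a root of A_n^{(s+1)}")] -/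
theorem sum_XtermA_root_eq_zero (s : ℕ) {δ : ℕ} (hδ : δ ≤ 1) (n : ℕ) {m : ℕ} (hm1 : 1 ≤ m) (hmn : m ≤ n) :
    ∑ k ∈ range (n + 1), XtermA s δ n k ((1 : ℚ) / 4 - m + k) = 0 := by
  have hx : ∀ j ∈ range (n + 1), (1 : ℚ) / 4 - m + j ≠ 0 := by
    intro j _ h
    have h4 : (4 * (j : ℤ) - 4 * m + 1 : ℤ) = 0 := by
      have : (4 * (j : ℚ) - 4 * m + 1) = 0 := by linarith
      exact_mod_cast this
    omega
  have h := iteratedDeriv_As s hδ n (s + 1) hx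
  rw [iteratedDeriv_As_quarter_eq_zero s δ n hm1 hmn] at h
  have h1 : ((-1 : ℚ) ^ (s + 1)) ≠ 0 := pow_ne_zero _ (by norm_num)
  have h2 := (mul_eq_zero.1 h.symm).resolve_left h1
  rw [← h2]
  refine sum_congr rfl fun k _ => ?_
  rw [XtermA]
  refine sum_congr rfl fun i _ => ?_
  rw [show i + (s + 1) = i + s + 1 by ring]

/-! ### Lemma 4.6, prime by prime -/

/-- `q`-integrality of one term: if `v_q(N) ≤ v_q(d_n)` (`‖d_n/N‖_q ≤ 1`) then `‖d_n^{3s+5} · X_{n,k}(N/4)‖_q ≤ 1` (`k ≤ n`),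
since `d_n^{3s+5}(i)_{s+1}a_{n,i,k}(N/4)^{−(i+s+1)} = (i)_{s+1}4^{i+s+1}·(d_n^{2s+4−i}a_{n,i,k})·(d_n/N)^{i+s+1}` with
`d_n^{2s+4−i}a_{n,i,k} ∈ ℤ` (Lemma 4.2). [cite: Lai2025TwoAdicZeta, Lemma 4.6 (proof: "we have by (ari_b) … It follows that v_q(ℓ₀+¼) > v_q(d_n)")] -/
theorem padicNorm_lcm_pow_mul_XtermA_le (q : ℕ) [Fact q.Prime] (s δ n : ℕ) {k : ℕ} (hk : k ≤ n) {N : ℤ}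
    (hN : N ≠ 0) (hle : padicNorm q ((Nat.lcmUpto n : ℚ) / N) ≤ 1) :
    padicNorm q ((Nat.lcmUpto n : ℚ) ^ (3 * s + 5) * XtermA s δ n k ((N : ℚ) / 4)) ≤ 1 := by
  have hN' : (N : ℚ) ≠ 0 := by exact_mod_cast hN
  rw [XtermA, mul_sum]
  refine padicNorm.sum_le' (fun i hi => ?_) zero_le_one
  have hi' := mem_Icc.1 hi
  obtain ⟨z, hz⟩ := exists_int_lcm_pow_mul_coeffAs s δ n hk i
  set d : ℚ := (Nat.lcmUpto n : ℚ) with hd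
  -- rewrite the term as `(i)_{s+1} 4^{i+s+1} · z · (d/N)^{i+s+1}`
  have e : d ^ (3 * s + 5) = d ^ (2 * s + 4 - i) * d ^ (i + s + 1) := by
    rw [← pow_add]; congr 1; omega
  have hexp : d ^ (3 * s + 5) * ((i.ascFactorial (s + 1) : ℚ) * coeffAs s δ n i k * ((((N : ℚ) / 4)) ^ (i + s + 1))⁻¹) =
      ((i.ascFactorial (s + 1) * 4 ^ (i + s + 1) : ℕ) : ℚ) * (z : ℚ) * (d / N) ^ (i + s + 1) := by
    rw [e, show d ^ (2 * s + 4 - i) * d ^ (i + s + 1) * ((i.ascFactorial (s + 1) : ℚ) * coeffAs s δ n i k *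
        ((((N : ℚ) / 4)) ^ (i + s + 1))⁻¹) = (i.ascFactorial (s + 1) : ℚ) * (d ^ (2 * s + 4 - i) * coeffAs s δ n i k) *
        (d ^ (i + s + 1) * ((((N : ℚ) / 4)) ^ (i + s + 1))⁻¹) by ring, hz, ← inv_pow, ← mul_pow,
      show d * (((N : ℚ) / 4))⁻¹ = 4 * (d / N) by field_simp, mul_pow]
    push_cast
    ring
  rw [hexp, padicNorm.mul, padicNorm.mul, IsAbsoluteValue.abv_pow (padicNorm q)]
  exact mul_le_one₀ (mul_le_one₀ (padicNorm.of_nat _) (padicNorm.nonneg _) (padicNorm.of_int _))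
    (pow_nonneg (padicNorm.nonneg _) _) (pow_le_one₀ (padicNorm.nonneg _) hle)

/-- **Each term of `ρ_{n,0}` is `d_n^{3s+5}`-integral**: `d_n^{3s+5} · X_{n,k}(ℓ+¼) ∈ ℤ` for `0 ≤ ℓ < k ≤ n` — at a prime
`q` with `v_q(4ℓ+1) ≤ v_q(d_n)` directly, and otherwise through the root relation at `m = k − ℓ`, all of whose other
terms are `q`-integral (no two bad shifts, tree `not_dvd_both`). [cite: Lai2025TwoAdicZeta, Lemma 4.6 (proof)] -/
theorem exists_int_lcm_pow_mul_XtermA (s : ℕ) {δ : ℕ} (hδ : δ ≤ 1) (n : ℕ) {k ℓ : ℕ} (hk : k ≤ n) (hℓ : ℓ < k) :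
    ∃ z : ℤ, (z : ℚ) = (Nat.lcmUpto n : ℚ) ^ (3 * s + 5) * XtermA s δ n k ((ℓ : ℚ) + 1 / 4) := by
  refine Literature.Algebra.Module.Rat.exists_int_eq_of_forall_padicNorm_le_one _ fun q hq => ?_
  haveI : Fact q.Prime := ⟨hq⟩
  have hN : (4 * (ℓ : ℤ) + 1 : ℤ) ≠ 0 := by omega
  have hy : ((ℓ : ℚ) + 1 / 4) = (((4 * (ℓ : ℤ) + 1 : ℤ)) : ℚ) / 4 := by push_cast; ring
  by_cases hgood : padicNorm q ((Nat.lcmUpto n : ℚ) / ((4 * (ℓ : ℤ) + 1 : ℤ) : ℚ)) ≤ 1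
  · rw [hy]
    exact padicNorm_lcm_pow_mul_XtermA_le q s δ n hk hN hgood
  · -- the bad case: use the root relation at `m = k − ℓ`
    have hbad := pow_log_succ_dvd_of_one_lt_padicNorm q n hN (not_le.1 hgood)
    have hm1 : 1 ≤ k - ℓ := by omega
    have hmn : k - ℓ ≤ n := by omega
    have hroot := sum_XtermA_root_eq_zero s hδ n hm1 hmn
    rw [← add_sum_erase _ _ (mem_range.2 (by omega : k < n + 1))] at hroot
    have hkk : (1 : ℚ) / 4 - ((k - ℓ : ℕ) : ℚ) + k = (ℓ : ℚ) + 1 / 4 := by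
      rw [Nat.cast_sub hℓ.le]; ring
    rw [hkk] at hroot
    have hX : (Nat.lcmUpto n : ℚ) ^ (3 * s + 5) * XtermA s δ n k ((ℓ : ℚ) + 1 / 4) =
        -∑ k' ∈ (range (n + 1)).erase k,
          (Nat.lcmUpto n : ℚ) ^ (3 * s + 5) * XtermA s δ n k' ((1 : ℚ) / 4 - ((k - ℓ : ℕ) : ℚ) + k') := by
      rw [← mul_sum, ← mul_neg]
      congr 1
      linarith
    rw [hX, padicNorm.neg]
    refine padicNorm.sum_le' (fun k' hk' => ?_) zero_le_one
    have hk'k : k' ≠ k := (mem_erase.1 hk').1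
    have hk'n : k' ≤ n := by have := mem_range.1 (mem_of_mem_erase hk'); omega
    have hN' : (4 * ((k' : ℤ) - k + ℓ) + 1 : ℤ) ≠ 0 := by omega
    have hy' : (1 : ℚ) / 4 - ((k - ℓ : ℕ) : ℚ) + k' = (((4 * ((k' : ℤ) - k + ℓ) + 1 : ℤ)) : ℚ) / 4 := by
      rw [Nat.cast_sub hℓ.le]; push_cast; ring
    rw [hy']
    refine padicNorm_lcm_pow_mul_XtermA_le q s δ n hk'n hN' ?_
    by_contra hgt
    exact not_dvd_both q n hk hk'n hk'k ℓ hbad (pow_log_succ_dvd_of_one_lt_padicNorm q n hN' (not_le.1 hgt))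

/-- **Lemma 4.6 (rho_0_ari), general `s`: `d_n^{3s+5} · ρ_{n,0} ∈ ℤ`.** [cite: Lai2025TwoAdicZeta, Lemma 4.6 (rho_0_ari)] -/
theorem exists_int_lcm_pow_mul_rhoZero (s : ℕ) {δ : ℕ} (hδ : δ ≤ 1) (n : ℕ) :
    ∃ z : ℤ, (Nat.lcmUpto n : ℚ) ^ (3 * s + 5) * rhoZero s δ n = z := by
  have h : ∀ k ∈ range (n + 1), ∀ ℓ ∈ range k, ∃ z : ℤ,
      (z : ℚ) = (Nat.lcmUpto n : ℚ) ^ (3 * s + 5) * XtermA s δ n k ((ℓ : ℚ) + 1 / 4) := fun k hk ℓ hℓ =>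
    exists_int_lcm_pow_mul_XtermA s hδ n (by have := mem_range.1 hk; omega) (mem_range.1 hℓ)
  choose! z hz using h
  refine ⟨(-1) ^ (s + 1) * ∑ k ∈ range (n + 1), ∑ ℓ ∈ range k, z k ℓ, ?_⟩
  rw [rhoZero, mul_left_comm, mul_sum]
  push_cast
  congr 1
  refine sum_congr rfl fun k hk => ?_
  rw [mul_sum]
  exact sum_congr rfl fun ℓ hℓ => (hz k hk ℓ hℓ).symm

/-! ## §5. Lemma 5.2 (general `s`, `A`-family): polynomial·`2^{(6s+12)n}` bounds for `ρ_{n,i}`, `ρ_{n,0}` -/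

/-- The constant `K_ρ(s) := (2s+5)·(3s+4)^{s+1}·4^{3s+6}·(10(s+2))^{2s+3}` of the explicit Lemma 5.2 for `ρ`.
[cite: Lai2025TwoAdicZeta, Lemma 5.2 (rho_est: the o(1) made explicit)] -/
def Krho (s : ℕ) : ℚ :=
  (2 * (s : ℚ) + 5) * (3 * (s : ℚ) + 4) ^ (s + 1) * 4 ^ (3 * s + 6) * (10 * ((s : ℚ) + 2)) ^ (2 * s + 3)

/-- `K_ρ(s) ≥ 1`. [cite: Lai2025TwoAdicZeta, Lemma 5.2] -/
theorem one_le_Krho (s : ℕ) : 1 ≤ Krho s := by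
  unfold Krho
  have hs : (0 : ℚ) ≤ s := Nat.cast_nonneg s
  have h1 : (1 : ℚ) ≤ 2 * (s : ℚ) + 5 := by linarith
  have h2 : (1 : ℚ) ≤ (3 * (s : ℚ) + 4) ^ (s + 1) := one_le_pow₀ (by linarith)
  have h3 : (1 : ℚ) ≤ 4 ^ (3 * s + 6) := one_le_pow₀ (by norm_num)
  have h4 : (1 : ℚ) ≤ (10 * ((s : ℚ) + 2)) ^ (2 * s + 3) := one_le_pow₀ (by linarith)
  calc (1 : ℚ) = 1 * 1 * 1 * 1 := by ring
    _ ≤ _ := by gcongr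

/-- One coefficient term: `(i)_{s+1}·|a_{n,i,k}|·4^e ≤ (3s+4)^{s+1}·4^{3s+5}·2^{(6s+12)n}·4(n+1)·(10(s+2)(n+1))^{2s+3}` for
`1 ≤ i ≤ 2s+4`, `e ≤ 3s+5`, `k ≤ n`, `δ ≤ 1`. [cite: Lai2025TwoAdicZeta, Lemma 5.2 (proof)] -/
theorem coeffA_term_le (s : ℕ) {δ : ℕ} (hδ : δ ≤ 1) (n : ℕ) {k : ℕ} (hk : k ≤ n) {i : ℕ} (hi : i ∈ Icc 1 (2 * s + 4))
    {e : ℕ} (he : e ≤ 3 * s + 5) :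
    (i.ascFactorial (s + 1) : ℚ) * |coeffAs s δ n i k| * 4 ^ e ≤
      (3 * (s : ℚ) + 4) ^ (s + 1) * 4 ^ (3 * s + 5) *
        ((2 : ℚ) ^ ((6 * s + 12) * n) * (4 * ((n : ℚ) + 1)) * (10 * ((s : ℚ) + 2) * (n + 1)) ^ (2 * s + 3)) := by
  have hi' := mem_Icc.1 hi
  have hs0 : (0 : ℚ) ≤ s := Nat.cast_nonneg s
  have hn0 : (0 : ℚ) ≤ n := Nat.cast_nonneg n
  have hδq : (δ : ℚ) ≤ 1 := by exact_mod_cast hδ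
  have hδ0 : (0 : ℚ) ≤ δ := Nat.cast_nonneg δ
  -- `(i)_{s+1} ≤ (i+s)^{s+1} ≤ (3s+4)^{s+1}`
  have hasc : (i.ascFactorial (s + 1) : ℚ) ≤ (3 * (s : ℚ) + 4) ^ (s + 1) := by
    obtain ⟨i', rfl⟩ : ∃ i', i = i' + 1 := ⟨i - 1, by omega⟩
    have h1 : (i' + 1).ascFactorial (s + 1) ≤ (i' + (s + 1)) ^ (s + 1) := Nat.ascFactorial_le_pow_add i' (s + 1)
    have h2 : (i' + (s + 1)) ^ (s + 1) ≤ (3 * s + 4) ^ (s + 1) := Nat.pow_le_pow_left (by omega) _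
    have h3 : ((i' + 1).ascFactorial (s + 1) : ℚ) ≤ ((3 * s + 4) ^ (s + 1) : ℕ) := by exact_mod_cast h1.trans h2
    refine h3.trans (le_of_eq ?_)
    push_cast; ring
  have h4 : (4 : ℚ) ^ e ≤ 4 ^ (3 * s + 5) := pow_le_pow_right₀ (by norm_num) he
  -- `|a| ≤ 2^{(6s+12)n}(4n+4)^δ(10(s+2)n+δ)^{2s+4−i} ≤ 2^{(6s+12)n}·4(n+1)·(10(s+2)(n+1))^{2s+3}`
  have hb : |coeffAs s δ n i k| ≤
      (2 : ℚ) ^ ((6 * s + 12) * n) * (4 * ((n : ℚ) + 1)) * (10 * ((s : ℚ) + 2) * (n + 1)) ^ (2 * s + 3) := by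
    refine (abs_coeffAs_le s δ n hk i).trans ?_
    have hlin : (4 * (n : ℚ) + 4) ^ δ ≤ 4 * ((n : ℚ) + 1) := by
      interval_cases δ
      · rw [pow_zero]; linarith
      · rw [pow_one]; linarith
    have hW : (1 : ℚ) ≤ 10 * ((s : ℚ) + 2) * (n + 1) := by nlinarith
    have hpow : (10 * ((s + 2 : ℕ) : ℚ) * n + δ) ^ (2 * s + 4 - i) ≤ (10 * ((s : ℚ) + 2) * (n + 1)) ^ (2 * s + 3) := by
      calc (10 * ((s + 2 : ℕ) : ℚ) * n + δ) ^ (2 * s + 4 - i) ≤ (10 * ((s : ℚ) + 2) * (n + 1)) ^ (2 * s + 4 - i) := by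
            apply pow_le_pow_left₀ (by positivity)
            push_cast; nlinarith
        _ ≤ (10 * ((s : ℚ) + 2) * (n + 1)) ^ (2 * s + 3) := pow_le_pow_right₀ hW (by omega)
    exact mul_le_mul (mul_le_mul_of_nonneg_left hlin (by positivity)) hpow (by positivity) (by positivity)
  calc (i.ascFactorial (s + 1) : ℚ) * |coeffAs s δ n i k| * 4 ^ e
      ≤ (3 * (s : ℚ) + 4) ^ (s + 1) *
          ((2 : ℚ) ^ ((6 * s + 12) * n) * (4 * ((n : ℚ) + 1)) * (10 * ((s : ℚ) + 2) * (n + 1)) ^ (2 * s + 3)) *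
          4 ^ (3 * s + 5) := by
        exact mul_le_mul (mul_le_mul hasc hb (abs_nonneg _) (by positivity)) h4 (by positivity) (by positivity)
    _ = _ := by ring

/-- **`|ρ_{n,i}| ≤ K_ρ(s)·(n+1)^{2s+6}·2^{(6s+12)n}`** (`1 ≤ i ≤ 2s+4`, `δ ≤ 1`). [cite: Lai2025TwoAdicZeta, Lemma 5.2 (rho_est)] -/
theorem abs_rhoI_le (s : ℕ) {δ : ℕ} (hδ : δ ≤ 1) (n : ℕ) {i : ℕ} (hi : i ∈ Icc 1 (2 * s + 4)) :
    |rhoI s δ n i| ≤ Krho s * ((n : ℚ) + 1) ^ (2 * s + 6) * 2 ^ ((6 * s + 12) * n) := by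
  have hi' := mem_Icc.1 hi
  have hs0 : (0 : ℚ) ≤ s := Nat.cast_nonneg s
  have hn0 : (0 : ℚ) ≤ n := Nat.cast_nonneg n
  set T : ℚ := (3 * (s : ℚ) + 4) ^ (s + 1) * 4 ^ (3 * s + 5) *
    ((2 : ℚ) ^ ((6 * s + 12) * n) * (4 * ((n : ℚ) + 1)) * (10 * ((s : ℚ) + 2) * (n + 1)) ^ (2 * s + 3)) with hT
  rw [rhoI, abs_mul, abs_mul, abs_mul, abs_pow, abs_neg, abs_one, one_pow, one_mul, Nat.abs_cast,
    abs_pow, show |(4 : ℚ)| = 4 by norm_num]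
  have hsum : |∑ k ∈ range (n + 1), coeffAs s δ n i k| ≤ ∑ k ∈ range (n + 1), |coeffAs s δ n i k| :=
    abs_sum_le_sum_abs _ _
  have hterms : ∀ k ∈ range (n + 1), (i.ascFactorial (s + 1) : ℚ) * |coeffAs s δ n i k| * 4 ^ (i + s) ≤ T :=
    fun k hk => coeffA_term_le s hδ n (by have := mem_range.1 hk; omega) hi (by omega)
  calc (i.ascFactorial (s + 1) : ℚ) * 4 ^ (i + s) * |∑ k ∈ range (n + 1), coeffAs s δ n i k|
      ≤ (i.ascFactorial (s + 1) : ℚ) * 4 ^ (i + s) * ∑ k ∈ range (n + 1), |coeffAs s δ n i k| :=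
        mul_le_mul_of_nonneg_left hsum (by positivity)
    _ = ∑ k ∈ range (n + 1), (i.ascFactorial (s + 1) : ℚ) * |coeffAs s δ n i k| * 4 ^ (i + s) := by
        rw [mul_sum]; exact sum_congr rfl fun k _ => by ring
    _ ≤ ∑ _k ∈ range (n + 1), T := sum_le_sum hterms
    _ = ((n : ℚ) + 1) * T := by rw [sum_const, card_range, nsmul_eq_mul]; push_cast; ring
    _ ≤ Krho s * ((n : ℚ) + 1) ^ (2 * s + 6) * 2 ^ ((6 * s + 12) * n) := by
        rw [hT, Krho, mul_pow]
        have h1 : (1 : ℚ) ≤ 2 * (s : ℚ) + 5 := by linarith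
        have hn1 : (1 : ℚ) ≤ (n : ℚ) + 1 := by linarith
        have hp : ((n : ℚ) + 1) * ((n : ℚ) + 1) * ((n : ℚ) + 1) ^ (2 * s + 3) ≤ ((n : ℚ) + 1) ^ (2 * s + 6) := by
          calc ((n : ℚ) + 1) * ((n : ℚ) + 1) * ((n : ℚ) + 1) ^ (2 * s + 3) = ((n : ℚ) + 1) ^ (2 * s + 5) := by ring
            _ ≤ ((n : ℚ) + 1) ^ (2 * s + 6) := pow_le_pow_right₀ hn1 (by omega)
        calc ((n : ℚ) + 1) * ((3 * (s : ℚ) + 4) ^ (s + 1) * 4 ^ (3 * s + 5) *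
              ((2 : ℚ) ^ ((6 * s + 12) * n) * (4 * ((n : ℚ) + 1)) *
                ((10 * ((s : ℚ) + 2)) ^ (2 * s + 3) * ((n : ℚ) + 1) ^ (2 * s + 3))))
            = 1 * (3 * (s : ℚ) + 4) ^ (s + 1) * (4 ^ (3 * s + 5) * 4) * (10 * ((s : ℚ) + 2)) ^ (2 * s + 3) *
                (((n : ℚ) + 1) * ((n : ℚ) + 1) * ((n : ℚ) + 1) ^ (2 * s + 3)) * (2 : ℚ) ^ ((6 * s + 12) * n) := by
              ring
          _ ≤ (2 * (s : ℚ) + 5) * (3 * (s : ℚ) + 4) ^ (s + 1) * 4 ^ (3 * s + 6) * (10 * ((s : ℚ) + 2)) ^ (2 * s + 3) *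
                ((n : ℚ) + 1) ^ (2 * s + 6) * (2 : ℚ) ^ ((6 * s + 12) * n) := by
              rw [show (4 : ℚ) ^ (3 * s + 5) * 4 = 4 ^ (3 * s + 6) by ring]
              gcongr

/-- `|X_{n,k}(ℓ + ¼)| ≤ (2s+4)·(3s+4)^{s+1}4^{3s+5}·2^{(6s+12)n}·4(n+1)·(10(s+2)(n+1))^{2s+3}` (`(ℓ+¼)^{−e} ≤ 4^e`).
[cite: Lai2025TwoAdicZeta, Lemma 5.2 (proof: the bound for ρ_{n,0})] -/
theorem abs_XtermA_le (s : ℕ) {δ : ℕ} (hδ : δ ≤ 1) (n : ℕ) {k : ℕ} (hk : k ≤ n) (ℓ : ℕ) :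
    |XtermA s δ n k ((ℓ : ℚ) + 1 / 4)| ≤ (2 * (s : ℚ) + 4) * ((3 * (s : ℚ) + 4) ^ (s + 1) * 4 ^ (3 * s + 5) *
      ((2 : ℚ) ^ ((6 * s + 12) * n) * (4 * ((n : ℚ) + 1)) * (10 * ((s : ℚ) + 2) * (n + 1)) ^ (2 * s + 3))) := by
  have hy : (1 / 4 : ℚ) ≤ (ℓ : ℚ) + 1 / 4 := by have : (0 : ℚ) ≤ ℓ := Nat.cast_nonneg ℓ; linarith
  have hy0 : (0 : ℚ) < (ℓ : ℚ) + 1 / 4 := by positivity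
  have hinv : ∀ e : ℕ, (((ℓ : ℚ) + 1 / 4) ^ e)⁻¹ ≤ 4 ^ e := by
    intro e
    rw [← inv_pow]
    refine pow_le_pow_left₀ (by positivity) ?_ e
    calc (((ℓ : ℚ) + 1 / 4))⁻¹ ≤ (1 / 4 : ℚ)⁻¹ := inv_anti₀ (by norm_num) hy
      _ = 4 := by norm_num
  rw [XtermA]
  refine (abs_sum_le_sum_abs _ _).trans ?_
  have hterm : ∀ i ∈ Icc 1 (2 * s + 4),
      |(i.ascFactorial (s + 1) : ℚ) * coeffAs s δ n i k * (((ℓ : ℚ) + 1 / 4) ^ (i + s + 1))⁻¹| ≤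
        (3 * (s : ℚ) + 4) ^ (s + 1) * 4 ^ (3 * s + 5) *
          ((2 : ℚ) ^ ((6 * s + 12) * n) * (4 * ((n : ℚ) + 1)) * (10 * ((s : ℚ) + 2) * (n + 1)) ^ (2 * s + 3)) := by
    intro i hi
    have hi' := mem_Icc.1 hi
    rw [abs_mul, abs_mul, Nat.abs_cast, abs_inv, abs_pow, abs_of_pos hy0]
    calc (i.ascFactorial (s + 1) : ℚ) * |coeffAs s δ n i k| * (((ℓ : ℚ) + 1 / 4) ^ (i + s + 1))⁻¹
        ≤ (i.ascFactorial (s + 1) : ℚ) * |coeffAs s δ n i k| * 4 ^ (i + s + 1) :=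
          mul_le_mul_of_nonneg_left (hinv _) (by positivity)
      _ ≤ _ := coeffA_term_le s hδ n hk hi (by omega)
  refine (sum_le_sum hterm).trans ?_
  rw [sum_const, Nat.card_Icc, show 2 * s + 4 + 1 - 1 = 2 * s + 4 by omega, nsmul_eq_mul]
  push_cast
  exact le_rfl

/-- **`|ρ_{n,0}| ≤ K_ρ(s)·(n+1)^{2s+6}·2^{(6s+12)n}`** (`δ ≤ 1`) — Lemma 5.2's `max_i|ρ_{n,i}| ≤ 2^{(6s+12+o(1))n}` at `i = 0`,
with an explicit polynomial factor. [cite: Lai2025TwoAdicZeta, Lemma 5.2 (rho_est)] -/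
theorem abs_rhoZero_le (s : ℕ) {δ : ℕ} (hδ : δ ≤ 1) (n : ℕ) :
    |rhoZero s δ n| ≤ Krho s * ((n : ℚ) + 1) ^ (2 * s + 6) * 2 ^ ((6 * s + 12) * n) := by
  have hs0 : (0 : ℚ) ≤ s := Nat.cast_nonneg s
  have hn0 : (0 : ℚ) ≤ n := Nat.cast_nonneg n
  set M : ℚ := (2 * (s : ℚ) + 4) * ((3 * (s : ℚ) + 4) ^ (s + 1) * 4 ^ (3 * s + 5) *
      ((2 : ℚ) ^ ((6 * s + 12) * n) * (4 * ((n : ℚ) + 1)) * (10 * ((s : ℚ) + 2) * (n + 1)) ^ (2 * s + 3))) with hM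
  have hM0 : 0 ≤ M := by positivity
  rw [rhoZero, abs_mul, abs_pow, abs_neg, abs_one, one_pow, one_mul]
  refine (abs_sum_le_sum_abs _ _).trans ?_
  have h : ∀ k ∈ range (n + 1), |∑ ℓ ∈ range k, XtermA s δ n k ((ℓ : ℚ) + 1 / 4)| ≤ ((n : ℚ) + 1) * M := by
    intro k hk
    have hkn : k ≤ n := by have := mem_range.1 hk; omega
    refine (abs_sum_le_sum_abs _ _).trans ?_
    refine (sum_le_sum fun ℓ _ => abs_XtermA_le s hδ n hkn ℓ).trans ?_
    rw [sum_const, card_range, nsmul_eq_mul]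
    refine mul_le_mul_of_nonneg_right ?_ hM0
    have : (k : ℚ) ≤ n := by exact_mod_cast hkn
    linarith
  refine (sum_le_sum h).trans ?_
  rw [sum_const, card_range, nsmul_eq_mul]
  push_cast
  have hn1 : (1 : ℚ) ≤ (n : ℚ) + 1 := by linarith
  have hp : ((n : ℚ) + 1) * ((n : ℚ) + 1) * ((n : ℚ) + 1) * ((n : ℚ) + 1) ^ (2 * s + 3) ≤
      ((n : ℚ) + 1) ^ (2 * s + 6) := by
    calc ((n : ℚ) + 1) * ((n : ℚ) + 1) * ((n : ℚ) + 1) * ((n : ℚ) + 1) ^ (2 * s + 3)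
        = ((n : ℚ) + 1) ^ (2 * s + 6) := by ring
      _ ≤ ((n : ℚ) + 1) ^ (2 * s + 6) := le_rfl
  have hs5 : 2 * (s : ℚ) + 4 ≤ 2 * (s : ℚ) + 5 := by linarith
  calc ((n : ℚ) + 1) * (((n : ℚ) + 1) * M)
      = (2 * (s : ℚ) + 4) * (3 * (s : ℚ) + 4) ^ (s + 1) * (4 ^ (3 * s + 5) * 4) * (10 * ((s : ℚ) + 2)) ^ (2 * s + 3) *
          (((n : ℚ) + 1) * ((n : ℚ) + 1) * ((n : ℚ) + 1) * ((n : ℚ) + 1) ^ (2 * s + 3)) *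
          (2 : ℚ) ^ ((6 * s + 12) * n) := by
        rw [hM, mul_pow]; ring
    _ ≤ (2 * (s : ℚ) + 5) * (3 * (s : ℚ) + 4) ^ (s + 1) * 4 ^ (3 * s + 6) * (10 * ((s : ℚ) + 2)) ^ (2 * s + 3) *
          ((n : ℚ) + 1) ^ (2 * s + 6) * (2 : ℚ) ^ ((6 * s + 12) * n) := by
        rw [show (4 : ℚ) ^ (3 * s + 5) * 4 = 4 ^ (3 * s + 6) by ring]
        gcongr
    _ = Krho s * ((n : ℚ) + 1) ^ (2 * s + 6) * 2 ^ ((6 * s + 12) * n) := by rw [Krho]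


/-- **The parity vanishing of `ρ_{n,i}`**: `ρ_{n,i} = 0` for `i + δ` odd (`δ ≤ 1`, `1 ≤ i ≤ 2s+4`) («So `ρ_{n,i} = 0` when
`i > 0` and `i ≢ δ (mod 2)`»). [cite: Lai2025TwoAdicZeta, Lemma 3.3 (proof, last paragraph)] -/
theorem rhoI_eq_zero_of_odd (s : ℕ) {δ : ℕ} (hδ : δ ≤ 1) (n : ℕ) {i : ℕ} (hi1 : 1 ≤ i) (hi2 : i ≤ 2 * s + 4)
    (hodd : Odd (i + δ)) : rhoI s δ n i = 0 := by
  rw [rhoI, sum_coeffAs_eq_zero_of_odd s hδ n hi1 hi2 hodd, mul_zero]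

end GeneralLinearFormsA

end Literature.NumberTheory.Irrationality.Lai2025TwoAdic
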